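import Literature.AlgebraicGeometry.HodgeTheory.FermatHodgeCharacterCriterion
import Literature.AlgebraicGeometry.HodgeTheory.FermatShiodaCondition
import HarnessLib

/-!
# Aoki's criterion at the top conductor, in multiset language — line `cancel-by-any-claim-lattice`, crux `HodgeFermatVarieties` (stmt-HodgeConjecture-1334)

Level-`5q` programme (cycle 2 of the line lead; classify the Hodge sextuples of `ℤ/5q`), stub
`stub_sum_inv_char_eq_zero_of_isHodgeMultiset`: for a Hodge multiset `s` of residues mod `m`
(Shioda's semigroup `Mₘ`, `FermatCharacter.IsHodgeMultiset`) and every ODD PRIMITIVE Dirichlet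
character `χ` mod `m`,

    ∑_{x ∈ s} χ(x)⁻¹ = 0.

This is Aoki's criterion [Aoki1983, Prop. 2.2] (the tree's `FermatCharacter.IsHodge.aoki_criterion`)
at the TOP conductor `f = m`. Write each entry as `x = (m/M)·w` with `M ∣ m` its exact level and `w`
a unit mod `M` (`FermatCharacter.exists_unit_lift_eq`). In the criterion only the entries with
`m ∣ M`, i.e. `M = m`, i.e. the UNIT entries, survive; for them the coefficient
`(φ(m)/φ(m)) · ∏_{p ∣ m} (1 - χ(p))` is `1` (`χ(p) = 0` for every prime `p ∣ m`) and `w = x`. The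
non-unit entries contribute `0` on both sides (`χ(x) = 0`, `0⁻¹ = 0`). Everything here is proved;
no named facts.

References: [Aoki1983] N. Aoki, Math. Ann. 266 (1983) 23–54, Prop. 2.1–2.2;
[Shioda1979PJA] T. Shioda, Proc. Japan Acad. 55A (1979), §1.
-/

set_option linter.dupNamespace false

noncomputable section

open Finset
open Literature.AlgebraicGeometry.HodgeTheory Literature.AlgebraicGeometry.HodgeTheory.FermatCharacter

namespace Summit.HodgeConjecture.HodgeConjecture.Theorems.CancelByAnyClaimLattice.FiveQ

/-- **One term of Aoki's criterion at the top conductor `f = m`.** For `x = (m/M)·w` with `M ∣ m`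
and `w` mod `M`: the term `[m ∣ M] · (φ(m)/φ(M)) · ∏_{p ∣ M} (1 - χ(p)) · χ(w mod m)⁻¹` of the
criterion equals `χ(x)⁻¹`. If `M = m` then `x = w`, the totient ratio is `1` and every Euler factor
is `1 - χ(p) = 1` (`p ∣ m` is not a unit mod `m`); if `M ≠ m` then `m ∤ M` and `x` is not a unit
(its factor `m/M ∣ m` would be a unit, forcing `m/M = 1`), so both sides vanish.
[cite: Aoki1983, Prop. 2.2] -/
theorem criterion_term_top {m : ℕ} [NeZero m] (χ : DirichletCharacter ℂ m) {M : ℕ} [NeZero M]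
    (hM : M ∣ m) (w : ZMod M) {x : ZMod m}
    (hx : x = ((m / M : ℕ) : ZMod m) * ((ZMod.val w : ℕ) : ZMod m)) :
    (if m ∣ M then ((m.totient : ℂ) / (M.totient : ℂ)) *
        (∏ p ∈ M.primeFactors, (1 - χ p)) * (χ (ZMod.cast w : ZMod m))⁻¹ else 0) = (χ x)⁻¹ := by
  by_cases hmM : m ∣ M
  · have hMm : M = m := Nat.dvd_antisymm hM hmM
    have h1 : m / M = 1 := by rw [hMm]; exact Nat.div_self (NeZero.pos m)
    have hxw : x = ((ZMod.val w : ℕ) : ZMod m) := by rw [hx, h1, Nat.cast_one, one_mul]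
    have hφ : (m.totient : ℂ) / (M.totient : ℂ) = 1 := by
      rw [hMm]
      exact div_self (by exact_mod_cast (Nat.totient_pos.mpr (NeZero.pos m)).ne')
    have hone : (∏ p ∈ M.primeFactors, (1 - χ p)) = 1 := by
      refine Finset.prod_eq_one fun p hp ↦ ?_
      have hpm : p ∣ m := (Nat.dvd_of_mem_primeFactors hp).trans hM
      have hp1 : p.Prime := Nat.prime_of_mem_primeFactors hp
      have hnu : ¬ IsUnit ((p : ℕ) : ZMod m) := by
        rw [ZMod.isUnit_iff_coprime]
        intro hc
        exact hp1.one_lt.ne' (Nat.Coprime.eq_one_of_dvd hc hpm)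
      rw [χ.map_nonunit hnu, sub_zero]
    rw [if_pos hmM, hφ, hone, one_mul, one_mul, ZMod.cast_eq_val, hxw]
  · rw [if_neg hmM]
    have hnu : ¬ IsUnit x := by
      intro hu
      rw [hx] at hu
      have hu1 := isUnit_of_mul_isUnit_left hu
      rw [ZMod.isUnit_iff_coprime] at hu1
      have h2 : m / M = 1 := Nat.Coprime.eq_one_of_dvd hu1 (Nat.div_dvd_of_dvd hM)
      exact hmM (by rw [Nat.eq_of_dvd_of_div_eq_one hM h2])
    rw [χ.map_nonunit hnu, inv_zero]

/-- **Aoki's criterion at the top conductor, for a Hodge character.** For a Hodge character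
`α : Fin k → ℤ/m` and every odd primitive `χ` mod `m`: `∑ᵢ χ(αᵢ)⁻¹ = 0` (the non-unit coordinates
contribute `χ(αᵢ)⁻¹ = 0`). This is `IsHodge.aoki_criterion` at `f = m` with `Mᵢ` the exact level of
`αᵢ` (`exists_unit_lift_eq`), term by term `criterion_term_top`. [cite: Aoki1983, Prop. 2.2] -/
theorem sum_inv_char_eq_zero_of_isHodge {m : ℕ} [NeZero m] {k : ℕ} {α : Fin k → ZMod m}
    (h : IsHodge α) (χ : DirichletCharacter ℂ m) (hχ : χ.Odd) (hprim : χ.IsPrimitive) :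
    ∑ i, (χ (α i))⁻¹ = 0 := by
  classical
  choose w hw hαw using fun i ↦ (exists_unit_lift_eq (α i)).2
  haveI : ∀ i, NeZero (m / m.gcd (α i).val) := fun i ↦
    ⟨(Nat.div_pos (Nat.le_of_dvd (NeZero.pos m) (Nat.gcd_dvd_left m (α i).val))
      (Nat.gcd_pos_of_pos_left _ (NeZero.pos m))).ne'⟩
  have key := h.aoki_criterion (dvd_refl m) hχ hprim (fun i ↦ m / m.gcd (α i).val)
    (fun i ↦ (exists_unit_lift_eq (α i)).1) w hw (fun i ↦ (hαw i).symm)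
  refine Eq.trans (Finset.sum_congr rfl fun i _ ↦ ?_) key
  exact (criterion_term_top χ (exists_unit_lift_eq (α i)).1 (w i) (hαw i).symm).symm

/-- **Aoki's criterion at the top conductor, in multiset language.** For a Hodge multiset `s` of
residues mod `m` (Shioda's semigroup `Mₘ`) and every odd primitive Dirichlet character `χ` mod `m`:
`∑_{x ∈ s} χ(x)⁻¹ = 0`. (Realise `s` as the multiset of values of a Hodge character,
`IsHodgeMultiset.exists_isHodge`, and apply `sum_inv_char_eq_zero_of_isHodge`.)
[cite: Aoki1983, Prop. 2.2] [cite: Shioda1979PJA, §1] -/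
theorem stub_sum_inv_char_eq_zero_of_isHodgeMultiset :
    ∀ (m : ℕ) [NeZero m] (s : Multiset (ZMod m)), IsHodgeMultiset s →
      ∀ χ : DirichletCharacter ℂ m, χ.Odd → χ.IsPrimitive → (s.map fun x ↦ (χ x)⁻¹).sum = 0 := by
  intro m _ s hs χ hχ hprim
  obtain ⟨k, α, hα, rfl⟩ := hs.exists_isHodge
  rw [Multiset.map_map, ← Finset.sum_eq_multiset_sum]
  exact sum_inv_char_eq_zero_of_isHodge hα χ hχ hprim

end Summit.HodgeConjecture.HodgeConjecture.Theorems.CancelByAnyClaimLattice.FiveQ
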